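import Summits.CriticalPhenomena.CardyFormulaZ2.Theses.CardySegmentWeakRSW
import Summits.CriticalPhenomena.CardyFormulaZ2.Theses.CardySelfDualSegment
import Summits.CriticalPhenomena.CardyFormulaZ2.Theorems.CardySelfDualSegmentSegmentClosedConfinementGates
import HarnessLib

/-!
# Route `CardySegmentWeakRSW`, rung `ClosedOfWeakBoxCrossing` (stmt-CriticalPhenomena-18421):
  the dial `UniformBoxCrossing ⟹ WeakBoxCrossing` and the rung's specialisation to its floor

The forward rung `ClosedOfWeakBoxCrossing` (route `CardySegmentWeakRSW`) is the proved floor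
`SegmentClosed` (route `CardySelfDualSegment`, `Theorems.segmentClosed_proof`) with its first
hypothesis moved along the dial

  `UniformBoxCrossing` (stmt-5476: t-uniform box-crossing bounds of the corner models `M_t` at every
  aspect ratio and every large scale)  ↦  `WeakBoxCrossing` (stmt-18422: for every `t` some `c > 0`
  such that at arbitrarily small meshes the crude bottom-to-top `M_t`-crossing probability of the box
  `(0,2) × (0,1)` is at most `1 - c`).

This file makes the dial a tree theorem:

* `weakBoxCrossing_of_uniformBoxCrossing : UniformBoxCrossing → WeakBoxCrossing` — a crude
  bottom-to-top crossing of `(0,2) × (0,1)` at mesh `1/n` contains (forced-gate sandwich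
  `stub_gateTB`, on configurations of lattice edges, `cornerPercolation_real_le_of_edgeSet`) a top–bottom crossing of a translated lattice box
  of width `2n` and height `n/2 = ¼ · 2n`, whose `M_t`-probability is at most `1 - c` by the box-crossing
  bound at aspect ratio `¼` (the easy direction of a wide box is still not almost sure under RSW);
* `segmentClosed_of_closedOfWeakBoxCrossing : ClosedOfWeakBoxCrossing → SegmentClosed` — the rung
  SPECIALISES to the floor statement along the dial (proved from the dial, not from the floor theorem):
  the forward discipline's F3 relation "rung at the floor's parameter = floor" for this birth.

No statement of either route is asserted unconditionally. [folklore]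

prover-fwd2-land-1-0 (on-path lander), 2026-08-18.
-/

noncomputable section

open Set Filter Metric MeasureTheory Complex
open scoped Topology
open Literature.Probability.RandomPlanarGeometry Literature.Probability.Percolation
open Literature.Probability.LatticeModels
open Summit.CriticalPhenomena.CardyFormulaZ2.Cruxes.SegmentClosed.Sketch
  (stub_gateTB cornerPercolation_real_le_of_edgeSet)

namespace Summit.CriticalPhenomena.CardyFormulaZ2.Theorems

/-- **Forced gate for the `2 × 1` box.** For `n ≥ 16` there is a translation `w` such that, on
configurations of lattice edges, a crude bottom-to-top crossing of `(0,2) × (0,1)` at mesh `1/n`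
(`embDomainCrossing`, vertices drawn on `√2 ℤ²` inside the open box, endpoints within `2/n` of the
bottom and top sides) contains a top–bottom crossing of the box `w + [0, 2n] × [0, ¼ · 2n]`
(`embTBCrossing`): `stub_gateTB` with `y₁ = 2/n`, `y₂ = 1 - 2/n`, `[x₁, x₂] = [0, 2]`, width
`a = 2n = 2 / n⁻¹` and height `b = n/2 ≤ n - 8`. [folklore] -/
theorem exists_embTBCrossing_of_crude_two_by_one {n : ℕ} (hn : 16 ≤ n) :
    ∃ w : ℂ, ∀ ω : BondConfig (Site 2), ω ⊆ (zdGraph 2).edgeSet →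
      ω ∈ embDomainCrossing squareLatticeEmbedding.z (rectQuad 0 2 0 1 two_pos one_pos).carrier
        ((n : ℝ)⁻¹) ((rectQuad 0 2 0 1 two_pos one_pos).arc 0) ((rectQuad 0 2 0 1 two_pos one_pos).arc 2) →
      ω ∈ embTBCrossing (fun v => squareLatticeEmbedding.z v - w) ((2 * n : ℕ) : ℝ)
        (1 / 4 * ((2 * n : ℕ) : ℝ)) := by
  have hn' : (16 : ℝ) ≤ n := by exact_mod_cast hn
  have hn0 : (0 : ℝ) < n := by linarith
  set δ : ℝ := (n : ℝ)⁻¹ with hδ_def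
  have hδ : 0 < δ := inv_pos.2 hn0
  have hnδ : (n : ℝ) * δ = 1 := mul_inv_cancel₀ hn0.ne'
  -- geometric hypotheses of the forced-gate sandwich for the open box `(0,2) × (0,1)`
  have hA : ∀ p ∈ (rectQuad 0 2 0 1 two_pos one_pos).carrier,
      infDist p ((rectQuad 0 2 0 1 two_pos one_pos).arc 0) ≤ 2 * δ → p.im ≤ 2 * δ := by
    intro p hp hd
    obtain ⟨-, hp0, -⟩ := (mem_rectQuad_carrier two_pos one_pos).1 hp
    have hne : ((rectQuad 0 2 0 1 two_pos one_pos).arc 0).Nonempty :=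
      ⟨⟨0, 0⟩, (mem_rectQuad_arc_zero two_pos one_pos).2 ⟨rfl, left_mem_Icc.2 two_pos.le⟩⟩
    have key : p.im ≤ infDist p ((rectQuad 0 2 0 1 two_pos one_pos).arc 0) := by
      refine (le_infDist hne).2 fun q hq => ?_
      have hq0 : q.im = 0 := ((mem_rectQuad_arc_zero two_pos one_pos).1 hq).1
      calc p.im = |(p - q).im| := by rw [sub_im, hq0, sub_zero, abs_of_pos hp0]
        _ ≤ ‖p - q‖ := abs_im_le_norm _
        _ = dist p q := (dist_eq_norm p q).symm
    exact key.trans hd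
  have hB : ∀ p ∈ (rectQuad 0 2 0 1 two_pos one_pos).carrier,
      infDist p ((rectQuad 0 2 0 1 two_pos one_pos).arc 2) ≤ 2 * δ → 1 - 2 * δ ≤ p.im := by
    intro p hp hd
    obtain ⟨-, -, hp1⟩ := (mem_rectQuad_carrier two_pos one_pos).1 hp
    have hne : ((rectQuad 0 2 0 1 two_pos one_pos).arc 2).Nonempty :=
      ⟨⟨0, 1⟩, (mem_rectQuad_arc_two two_pos one_pos).2 ⟨rfl, left_mem_Icc.2 two_pos.le⟩⟩
    have key : 1 - p.im ≤ infDist p ((rectQuad 0 2 0 1 two_pos one_pos).arc 2) := by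
      refine (le_infDist hne).2 fun q hq => ?_
      have hq1 : q.im = 1 := ((mem_rectQuad_arc_two two_pos one_pos).1 hq).1
      calc 1 - p.im = |(p - q).im| := by
            rw [sub_im, hq1, abs_of_nonpos (by linarith)]; ring
        _ ≤ ‖p - q‖ := abs_im_le_norm _
        _ = dist p q := (dist_eq_norm p q).symm
    linarith [key.trans hd]
  have hΩ : ∀ p ∈ (rectQuad 0 2 0 1 two_pos one_pos).carrier,
      2 * δ ≤ p.im → p.im ≤ 1 - 2 * δ → (0 : ℝ) ≤ p.re ∧ p.re ≤ 2 := by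
    intro p hp _ _
    obtain ⟨⟨h0, h2⟩, -⟩ := (mem_rectQuad_carrier two_pos one_pos).1 hp
    exact ⟨h0.le, h2.le⟩
  have hcast : ((2 * n : ℕ) : ℝ) = 2 * n := by push_cast; ring
  have hb : (0 : ℝ) ≤ 1 / 4 * ((2 * n : ℕ) : ℝ) := by rw [hcast]; positivity
  have hby : 1 / 4 * ((2 * n : ℕ) : ℝ) ≤ (1 - 2 * δ - 2 * δ) / δ - 4 := by
    rw [hcast]
    have : (1 - 2 * δ - 2 * δ) / δ = n - 4 := by
      field_simp
      nlinarith [hnδ]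
    rw [this]
    linarith
  have ha : (2 - 0) / δ ≤ ((2 * n : ℕ) : ℝ) := by
    rw [hcast, sub_zero, div_eq_mul_inv, hδ_def, inv_inv]
  exact stub_gateTB (rectQuad 0 2 0 1 two_pos one_pos).carrier
    ((rectQuad 0 2 0 1 two_pos one_pos).arc 0) ((rectQuad 0 2 0 1 two_pos one_pos).arc 2)
    hδ hA hB hΩ hb hby ha

/-- **The dial of the rung: uniform box crossing implies weak box crossing.**
`UniformBoxCrossing` (crux stmt-CriticalPhenomena-5476 of route `CardySelfDualSegment`: for every
aspect ratio, t-UNIFORM two-sided box-crossing bounds of the corner models `M_t` at all large scales)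
implies `WeakBoxCrossing` (crux stmt-CriticalPhenomena-18422 of route `CardySegmentWeakRSW`: for every
`t` some `c > 0` such that for every `δ₀ > 0` some mesh `δ ∈ (0, δ₀)` has crude bottom-to-top
`M_t`-crossing probability of `(0,2) × (0,1)` at most `1 - c`). Proof: take the box-crossing
constant `c` at aspect ratio `¼` and the mesh `δ = 1/n`, `n ≥ max 16 n₀`, `n > 1/δ₀`; by
`exists_embTBCrossing_of_crude_two_by_one` the crude crossing is contained in a top–bottom crossing of
a `2n × n/2` lattice box, of probability `≤ 1 - c`. (The law `(prodBernoulli (prm t)).map cfg` of the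
route files is `cornerPercolation t` and their `P t R δ` is `cornerCrossingProb t R δ`, by `rfl`.)
[folklore] -/
theorem weakBoxCrossing_of_uniformBoxCrossing
    (h : Summit.CriticalPhenomena.CardyFormulaZ2.Theses.CardySelfDualSegment.UniformBoxCrossing) :
    Summit.CriticalPhenomena.CardyFormulaZ2.Theses.CardySegmentWeakRSW.WeakBoxCrossing := by
  intro t
  obtain ⟨c, hc, n₀, hB⟩ := h (1 / 4) (by norm_num)
  have hBt : BoxCrossingBounds (cornerPercolation t) squareLatticeEmbedding.z (1 / 4) c n₀ := hB t
  refine ⟨c, hc, fun δ₀ hδ₀ => ?_⟩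
  obtain ⟨n, hn⟩ := exists_nat_gt (max 16 (max (n₀ : ℝ) δ₀⁻¹))
  have h16 : (16 : ℝ) < n := lt_of_le_of_lt (le_max_left _ _) hn
  have hn₀ : (n₀ : ℝ) < n := lt_of_le_of_lt ((le_max_left _ _).trans (le_max_right _ _)) hn
  have hδ₀n : δ₀⁻¹ < n := lt_of_le_of_lt ((le_max_right _ _).trans (le_max_right _ _)) hn
  have hn0 : (0 : ℝ) < n := by linarith
  have h16' : 16 ≤ n := by exact_mod_cast h16.le
  have hN : n₀ ≤ 2 * n := by
    have : n₀ < n := by exact_mod_cast hn₀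
    omega
  refine ⟨(n : ℝ)⁻¹, inv_pos.2 hn0, ?_, ?_⟩
  · rwa [inv_lt_comm₀ hn0 hδ₀]
  · show cornerCrossingProb t (rectQuad 0 2 0 1 two_pos one_pos) (n : ℝ)⁻¹ ≤ 1 - c
    obtain ⟨w, hw⟩ := exists_embTBCrossing_of_crude_two_by_one h16'
    obtain ⟨-, -, hup⟩ := hBt (2 * n) hN w
    rw [cornerCrossingProb_eq]
    exact (cornerPercolation_real_le_of_edgeSet t hw).trans hup

/-- **The rung specialises to its floor.** `ClosedOfWeakBoxCrossing` (the forward rung of route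
`CardySegmentWeakRSW`: pointwise weak box crossing + uniform marginality ⟹ the Cardy-good set
`G = {t | ∃ α, 0 < im α ∧ CardyMod t α}` of the corner segment is closed) implies the floor statement
`SegmentClosed` of route `CardySelfDualSegment` (uniform box crossing + uniform marginality ⟹ `G`
closed): feed the rung through the dial `weakBoxCrossing_of_uniformBoxCrossing`; the two routes'
`UniformMarginality` hypotheses and good sets are syntactically the same. This is the F3 relation of
the forward discipline for this birth (rung at the floor's dial position = floor), proved along the
dial and not by citing the floor theorem `segmentClosed_proof`. [folklore] -/
theorem segmentClosed_of_closedOfWeakBoxCrossing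
    (h : Summit.CriticalPhenomena.CardyFormulaZ2.Theses.CardySegmentWeakRSW.ClosedOfWeakBoxCrossing) :
    Summit.CriticalPhenomena.CardyFormulaZ2.Theses.CardySelfDualSegment.SegmentClosed := by
  intro hU hM
  exact h (weakBoxCrossing_of_uniformBoxCrossing hU) hM

end Summit.CriticalPhenomena.CardyFormulaZ2.Theorems

end
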